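import Literature.NumberTheory.Automorphic.GL2ComplexCasimirScalar
import HarnessLib

/-!
# Stub `stub_complexFactorCasimir` (crux `RegularTwistCM`, stmt-Langlands-14069, line `petersson-hermitian-purity`):
# the complex-place dictionary for a real `𝔤𝔩₂(ℂ)`-module with a Harish-Chandra parameter

Stub C2 of the lead skeleton of the crux `RegularTwistCM` (route `IrreducibilityBySelfDuality`). The crux needs
the integral pairing `s_i - t_j ∈ ℤ` of the Harish-Chandra parameters `{s₁, s₂}` (embedding `id`) and `{t₁, t₂}`
(embedding `conj`) of a `GL₂` datum at a complex place; the `(𝔤, K)`-module argument of the line consumes EXPLICIT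
operators, and this stub is the dictionary from the abstract predicate `HasHCParameter ρ χ` (`HarishChandraGL`,
`𝕜 = ℂ`, `n = 2`; `ρ : 𝔤𝔩₂(ℂ) →ₗ⁅ℝ⁆ End V` a REAL Lie algebra homomorphism, `χ` indexed by `τ ∈ {id, conj}`) to
two commuting complex-linear `𝔤𝔩₂(ℂ)`-actions `L`, `R` with `ρ X = L X + R X̄` and the scalars `L(1) = s₁ + s₂`,
`∑ L(E_{ab}) L(E_{ba}) = s₁² + s₂² - ½` (`χ(id) = {s₁, s₂}`), `R(1) = t₁ + t₂`, `∑ R(E_{ab}) R(E_{ba}) = t₁² + t₂² - ½`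
(`χ(conj) = {t₁, t₂}`).

The mathematics (Knapp 2002, Thm. 5.44 at `𝕜 = ℂ`; §VI.1 for the complexification) is the Literature file
`Literature.NumberTheory.Automorphic.GL2ComplexCasimirScalar`: the factorisation `GLnComplexCasimir.ofRho ρ`
(`L = Φ_id : X ↦ ½ (ρ X - i ρ(iX))`, `R = Φ_conj : Y ↦ ½ (ρ Ȳ + i ρ(i Ȳ))`), the real Casimir elements `C₊`, `C₋`
and `Z(u) = ι(u · 1)` of `U_ℝ(𝔤𝔩₂(ℂ))` with their Harish-Chandra polynomials, and
`GL2ComplexCasimir.scalars_of_hasHCParameter`. This file only assembles the registered signature; each half needs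
only its own enumeration (the other factor's comes from `card (χ τ) = 2`). Axioms: `propext`, `Classical.choice`,
`Quot.sound`.

## References

* A. W. Knapp, *Lie Groups Beyond an Introduction*, 2nd ed. (2002), Thm. 5.44, §VI.1. [Knapp2002]
* L. Clozel, *Motifs et formes automorphes* (1990), §3.3. [Clozel1990]
-/

set_option linter.dupNamespace false -- project-wide option; `Summit.Langlands.Langlands` is the mandated namespace

-- Mathlib idiom (Mathlib/Algebra/Lie/OfAssociative.lean), as in `HarishChandraGL`: commutator brackets on matrix
-- algebras and on `Module.End`, needed to state `Matrix (Fin 2) (Fin 2) ℂ →ₗ⁅_⁆ Module.End ℂ V`.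
attribute [local instance 100] LieRing.ofAssociativeRing

noncomputable section

open Literature.NumberTheory.Automorphic

namespace Summit.Langlands.Langlands.Theorems.RegularTwistCM

/-- **C2, the complex-place dictionary at `n = 2`** (Knapp 2002, Thm. 5.44 for `𝔤𝔩₂(ℂ)` as a real Lie algebra,
§VI.1 for `𝔤𝔩₂(ℂ) ⊗_ℝ ℂ ≅ 𝔤𝔩₂(ℂ)_{id} × 𝔤𝔩₂(ℂ)_{conj}`): a real `𝔤𝔩₂(ℂ)`-module `ρ` with Harish-Chandra
parameter `χ` is the restriction of two commuting complex-linear `𝔤𝔩₂(ℂ)`-actions `L X = ½ (ρ X - i ρ(iX))`,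
`R Y = ½ (ρ Ȳ + i ρ(i Ȳ))`, `ρ X = L X + R X̄`, whose centres and Casimir operators `∑_{a,b} E_{ab} E_{ba}` act by
`s₁ + s₂`, `s₁² + s₂² - ½` (`χ id = {s₁, s₂}`) and `t₁ + t₂`, `t₁² + t₂² - ½` (`χ conj = {t₁, t₂}`)
(`GL2ComplexCasimir.scalars_of_hasHCParameter`). [cite: Knapp2002, Thm. 5.44] -/
theorem stub_complexFactorCasimir {V : Type*} [AddCommGroup V] [Module ℂ V]
    (ρ : Matrix (Fin 2) (Fin 2) ℂ →ₗ⁅ℝ⁆ Module.End ℂ V) (χ : (ℂ →ₐ[ℝ] ℂ) → Multiset ℂ)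
    (hχ : HasHCParameter ρ χ) :
    ∃ L R : Matrix (Fin 2) (Fin 2) ℂ →ₗ⁅ℂ⁆ Module.End ℂ V,
      (∀ X Y : Matrix (Fin 2) (Fin 2) ℂ, L X * R Y = R Y * L X) ∧
      (∀ X : Matrix (Fin 2) (Fin 2) ℂ, ρ X = L X + R (X.map (starRingEnd ℂ))) ∧
      (∀ s₁ s₂ : ℂ, χ (AlgHom.id ℝ ℂ) = {s₁, s₂} →
        L 1 = (s₁ + s₂) • (1 : Module.End ℂ V) ∧
        ∑ a : Fin 2, ∑ b : Fin 2, L (Matrix.single a b 1) * L (Matrix.single b a 1) =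
          (s₁ ^ 2 + s₂ ^ 2 - 1 / 2) • (1 : Module.End ℂ V)) ∧
      (∀ t₁ t₂ : ℂ, χ (Complex.conjAe : ℂ →ₐ[ℝ] ℂ) = {t₁, t₂} →
        R 1 = (t₁ + t₂) • (1 : Module.End ℂ V) ∧
        ∑ a : Fin 2, ∑ b : Fin 2, R (Matrix.single a b 1) * R (Matrix.single b a 1) =
          (t₁ ^ 2 + t₂ ^ 2 - 1 / 2) • (1 : Module.End ℂ V)) := by
  refine ⟨(GLnComplexCasimir.ofRho ρ).toFun (AlgHom.id ℝ ℂ),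
    (GLnComplexCasimir.ofRho ρ).toFun (Complex.conjAe : ℂ →ₐ[ℝ] ℂ),
    fun X Y => (GLnComplexCasimir.ofRho ρ).commute _ _ GLnComplexCasimir.id_ne_conjAe X Y,
    fun X => GLnComplexCasimir.rho_eq_add ρ X, fun s₁ s₂ hs => ?_, fun t₁ t₂ ht => ?_⟩
  · obtain ⟨t₁, t₂, ht⟩ := Multiset.card_eq_two.mp (hχ.1 (Complex.conjAe : ℂ →ₐ[ℝ] ℂ))
    have h := GL2ComplexCasimir.scalars_of_hasHCParameter ρ hχ hs ht
    exact ⟨h.1.1, h.2.1⟩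
  · obtain ⟨s₁, s₂, hs⟩ := Multiset.card_eq_two.mp (hχ.1 (AlgHom.id ℝ ℂ))
    have h := GL2ComplexCasimir.scalars_of_hasHCParameter ρ hχ hs ht
    exact ⟨h.1.2, h.2.2⟩

end Summit.Langlands.Langlands.Theorems.RegularTwistCM

end
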